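import Mathlib
import HarnessLib
import Summits.Ventures.LatticeQCDFlow.Scoring.ReversibleKernelTauIntFloor

/-!
# PALINDROMIC SWEEPS ARE REVERSIBLE: `κ† ∘ₖ κ`, `κ† ∘ₖ ρ ∘ₖ κ` (`ρ` reversible) and the forward-then-backward cycle `cycle (Ks ++ Ks.reverse)` of reversible updates are `π`-reversible kernels — so the reversible-sampler toolbox (pair positivity, even lags, the `τ_int` floor) applies to them

HONEST FRAMING: exact (Metropolis-corrected) sampling algorithms for lattice gauge theory;
figures of merit are autocorrelation/cost numbers at stated couplings and volumes; no
continuum-physics claim.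

Venture `LatticeQCDFlow` (cell pub-lqcd), topic `Scoring`; FANOUT row 8 (`s0-cpn-nemc`, GEN-24).
NEW WORK of the cell over row 9's adjoint-pair calculus for Mathlib kernels
(`Exactness/AdjointKernels`: `IsAdjointPair`, `IsAdjointPair.comp` — adjoints compose in the opposite
order —, `isAdjointPair_cycle_reverse`, `cycle` of `Exactness/InvariantComposition`) and the
reversible-kernel corollaries of `Scoring/ReversibleKernelTauIntFloor` (pair positivity, even lags are
squares, the `τ_int` floor `(1 + ρ₁)/(2(1 − ρ₁))`).  Elementary; nothing is cited as a fact.  Printed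
counterparts NAMED ONLY: the forward–backward ("symmetric") sweep of the deterministic-scan Gibbs
sampler / SSOR, reversible by construction (Roberts–Sahu 1997; Fishman 1996); Neal 2004.

## Why (rows 8 / 9 / 21: sweeps, NE-MCMC forward/reverse protocols)

A single ordered sweep `F = cycle Ks` of reversible local updates is NOT reversible
(`Exactness/SequentialScanAdjoint`, `AdjointKernels`): none of the reversible-sampler certificates of
the tree (Geyer's initial sequences, even-lag positivity and ratios, the Madras–Sokal-type `τ_int`
floor, the variational floor) applies to it as such.  The PALINDROMIC sweep — forward then backward,
`cycle (Ks ++ Ks.reverse) = F ∘ₖ F†` — IS reversible, at the same cost per elementary update, and so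
is every palindrome with a reversible centre (`F ∘ₖ ρ ∘ₖ F†`: e.g. sweep, global move, reversed sweep).
This file records these closure facts for Mathlib kernels on a general measurable state space and
instantiates the reversible toolbox for them.

## Content (`π` finite; kernels Markov; `(κ, κ')` a `π`-adjoint pair, `IsAdjointPair κ κ' π`)

* **`isReversible_adjoint_comp`** — `Kernel.IsReversible (κ' ∘ₖ κ) π` (first `κ`, then its adjoint);
  `isReversible_comp_adjoint` — `Kernel.IsReversible (κ ∘ₖ κ') π`;
  **`isReversible_adjoint_comp_comp`** — `ρ` `π`-reversible ⇒ `Kernel.IsReversible (κ' ∘ₖ (ρ ∘ₖ κ)) π`;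
* **`isReversible_cycle_append_reverse`** — `Ks` a list of `π`-reversible Markov kernels ⇒
  `Kernel.IsReversible (cycle (Ks ++ Ks.reverse)) π`; `isReversible_cycle_append_cons_reverse` — with a
  reversible centre `ρ`: `Kernel.IsReversible (cycle (Ks ++ ρ :: Ks.reverse)) π`;
* the toolbox for the palindromic sweep `P = cycle (Ks ++ Ks.reverse)` (`π` a probability law, `g`
  bounded measurable, `C(t) = autocov P π g t`, `ρ(t) = C(t)/C(0)`):
  `autocov_even_nonneg_cycle_append_reverse` (`0 ≤ C(2m)`), `autocov_pair_nonneg_cycle_append_reverse`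
  (`0 ≤ C(2m) + C(2m+1)`), **`tauInt_ge_cycle_append_reverse`** (summable `ρ`, `ρ(1) < 1` ⇒
  `(1 + ρ(1))/(2(1 − ρ(1))) ≤ τ_int`).

NOT CLAIMED: positivity of ALL autocovariances of `κ† ∘ₖ κ` (true — it is the positive operator
`T T†` — but it needs adjointness on observables, companion file); any comparison between the
palindromic and the one-directional sweep; any number of ours.
-/

noncomputable section

namespace Summit.Ventures.LatticeQCDFlow.Scoring

open MeasureTheory ProbabilityTheory Filter Finset Summit.Ventures.LatticeQCDFlow.Exactness
open scoped ENNReal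

variable {Ω : Type*} [MeasurableSpace Ω] {π : Measure Ω}

/-! ### §1 Palindromes of an adjoint pair are reversible -/

section Pair

variable [IsFiniteMeasure π] {κ κ' ρ : Kernel Ω Ω} [IsMarkovKernel κ] [IsMarkovKernel κ']

/-- **`κ† ∘ₖ κ` is reversible**: for a `π`-adjoint pair `(κ, κ')`, the kernel "first `κ`, then `κ'`"
is `π`-reversible. -/
theorem isReversible_adjoint_comp (h : IsAdjointPair κ κ' π) : Kernel.IsReversible (κ' ∘ₖ κ) π :=
  isAdjointPair_self_iff.mp (h.comp h.symm)

/-- **`κ ∘ₖ κ†` is reversible** (the other palindrome). -/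
theorem isReversible_comp_adjoint (h : IsAdjointPair κ κ' π) : Kernel.IsReversible (κ ∘ₖ κ') π :=
  isAdjointPair_self_iff.mp (h.symm.comp h)

/-- **Palindromes with a reversible centre are reversible**: `ρ` `π`-reversible ⇒
`κ' ∘ₖ (ρ ∘ₖ κ)` ("`κ`, then `ρ`, then `κ†`") is `π`-reversible. -/
theorem isReversible_adjoint_comp_comp [IsMarkovKernel ρ] (h : IsAdjointPair κ κ' π)
    (hρ : Kernel.IsReversible ρ π) : Kernel.IsReversible (κ' ∘ₖ (ρ ∘ₖ κ)) π := by
  have h1 : IsAdjointPair (ρ ∘ₖ κ) (κ' ∘ₖ ρ) π := h.comp hρ.isAdjointPair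
  have h2 : IsAdjointPair (κ' ∘ₖ (ρ ∘ₖ κ)) ((κ' ∘ₖ ρ) ∘ₖ κ) π := h1.comp h.symm
  rw [Kernel.comp_assoc] at h2
  exact isAdjointPair_self_iff.mp h2

end Pair

/-! ### §2 The forward-then-backward sweep of reversible updates -/

section Cycles

variable [IsFiniteMeasure π]

/-- **THE PALINDROMIC SWEEP IS REVERSIBLE**: for every list `Ks` of `π`-reversible Markov kernels,
`cycle (Ks ++ Ks.reverse)` (`= cycle Ks ∘ₖ cycle Ks.reverse`) is `π`-reversible. -/
theorem isReversible_cycle_append_reverse {Ks : List (Kernel Ω Ω)} (hM : ∀ κ ∈ Ks, IsMarkovKernel κ)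
    (hrev : ∀ κ ∈ Ks, Kernel.IsReversible κ π) :
    Kernel.IsReversible (cycle (Ks ++ Ks.reverse)) π := by
  haveI := isMarkovKernel_cycle hM
  haveI : IsMarkovKernel (cycle Ks.reverse) :=
    isMarkovKernel_cycle fun η hη => hM η (List.mem_reverse.mp hη)
  rw [cycle_append]
  exact isReversible_comp_adjoint (isAdjointPair_cycle_reverse hM hrev)

/-- **Palindromic sweep with a reversible centre**: `cycle (Ks ++ ρ :: Ks.reverse)` is `π`-reversible
for `π`-reversible `ρ` and `Ks`. -/
theorem isReversible_cycle_append_cons_reverse {Ks : List (Kernel Ω Ω)} {ρ : Kernel Ω Ω}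
    [IsMarkovKernel ρ] (hM : ∀ κ ∈ Ks, IsMarkovKernel κ) (hrev : ∀ κ ∈ Ks, Kernel.IsReversible κ π)
    (hρ : Kernel.IsReversible ρ π) :
    Kernel.IsReversible (cycle (Ks ++ ρ :: Ks.reverse)) π := by
  haveI := isMarkovKernel_cycle hM
  haveI : IsMarkovKernel (cycle Ks.reverse) :=
    isMarkovKernel_cycle fun η hη => hM η (List.mem_reverse.mp hη)
  rw [cycle_append, cycle_cons]
  -- `cycle Ks ∘ₖ (ρ ∘ₖ cycle Ks.reverse)` with `(cycle Ks.reverse, cycle Ks)` an adjoint pair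
  exact isReversible_adjoint_comp_comp (isAdjointPair_cycle_reverse hM hrev).symm hρ

/-- The palindromic sweep is Markov. -/
theorem isMarkovKernel_cycle_append_reverse {Ks : List (Kernel Ω Ω)} (hM : ∀ κ ∈ Ks, IsMarkovKernel κ) :
    IsMarkovKernel (cycle (Ks ++ Ks.reverse)) :=
  isMarkovKernel_cycle fun η hη => by
    rcases List.mem_append.mp hη with h | h
    · exact hM η h
    · exact hM η (List.mem_reverse.mp h)

end Cycles

/-! ### §3 The reversible toolbox for the palindromic sweep -/

section Toolbox

variable [IsProbabilityMeasure π]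

/-- **Even lags are nonnegative** for the palindromic sweep: `0 ≤ autocov (cycle (Ks ++ Ks.reverse)) π g (2m)`. -/
theorem autocov_even_nonneg_cycle_append_reverse {Ks : List (Kernel Ω Ω)}
    (hM : ∀ κ ∈ Ks, IsMarkovKernel κ) (hrev : ∀ κ ∈ Ks, Kernel.IsReversible κ π) {g : Ω → ℝ}
    (hg : Measurable g) {B : ℝ} (hB : ∀ x, |g x| ≤ B) (m : ℕ) :
    (haveI := isMarkovKernel_cycle_append_reverse hM
     0 ≤ autocov (cycle (Ks ++ Ks.reverse)) π g (2 * m)) := by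
  haveI := isMarkovKernel_cycle_append_reverse hM
  exact autocov_even_nonneg_of_isReversible (isReversible_cycle_append_reverse hM hrev) hg hB m

/-- **Pair positivity** for the palindromic sweep: `0 ≤ C(2m) + C(2m+1)`. -/
theorem autocov_pair_nonneg_cycle_append_reverse {Ks : List (Kernel Ω Ω)}
    (hM : ∀ κ ∈ Ks, IsMarkovKernel κ) (hrev : ∀ κ ∈ Ks, Kernel.IsReversible κ π) {g : Ω → ℝ}
    (hg : Measurable g) {B : ℝ} (hB : ∀ x, |g x| ≤ B) (m : ℕ) :
    (haveI := isMarkovKernel_cycle_append_reverse hM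
     0 ≤ autocov (cycle (Ks ++ Ks.reverse)) π g (2 * m)
       + autocov (cycle (Ks ++ Ks.reverse)) π g (2 * m + 1)) := by
  haveI := isMarkovKernel_cycle_append_reverse hM
  exact autocov_pair_nonneg_of_isReversible (isReversible_cycle_append_reverse hM hrev) hg hB m

/-- **THE `τ_int` FLOOR FOR THE PALINDROMIC SWEEP**: with `P = cycle (Ks ++ Ks.reverse)`,
`ρ(t) = autocov P π g t / autocov P π g 0` summable beyond lag `0` and `ρ(1) < 1`:
`(1 + ρ(1))/(2(1 − ρ(1))) ≤ τ_int` (`Scoring.tauInt`). -/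
theorem tauInt_ge_cycle_append_reverse {Ks : List (Kernel Ω Ω)}
    (hM : ∀ κ ∈ Ks, IsMarkovKernel κ) (hrev : ∀ κ ∈ Ks, Kernel.IsReversible κ π) {g : Ω → ℝ}
    (hg : Measurable g) {B : ℝ} (hB : ∀ x, |g x| ≤ B)
    (hs : haveI := isMarkovKernel_cycle_append_reverse hM
      Summable fun t => autocov (cycle (Ks ++ Ks.reverse)) π g (t + 1)
        / autocov (cycle (Ks ++ Ks.reverse)) π g 0)
    (hρ : haveI := isMarkovKernel_cycle_append_reverse hM
      autocov (cycle (Ks ++ Ks.reverse)) π g 1 / autocov (cycle (Ks ++ Ks.reverse)) π g 0 < 1) :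
    (haveI := isMarkovKernel_cycle_append_reverse hM
     (1 + autocov (cycle (Ks ++ Ks.reverse)) π g 1 / autocov (cycle (Ks ++ Ks.reverse)) π g 0)
         / (2 * (1 - autocov (cycle (Ks ++ Ks.reverse)) π g 1 / autocov (cycle (Ks ++ Ks.reverse)) π g 0))
       ≤ tauInt (fun t => autocov (cycle (Ks ++ Ks.reverse)) π g t
           / autocov (cycle (Ks ++ Ks.reverse)) π g 0)) := by
  haveI := isMarkovKernel_cycle_append_reverse hM
  exact tauInt_ge_of_isReversible (isReversible_cycle_append_reverse hM hrev) hg hB hs hρ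

end Toolbox

end Summit.Ventures.LatticeQCDFlow.Scoring
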